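import Summits.ValiantsHypothesis.ValiantsHypothesis.Theorems.BarrierLeverChowBenchmarkPairsSplitStep

/-!
# Route BarrierLever — item 22038 `ChowBenchmarkPairs`, line `moore-peel`: THEOREM PS in the kernel —
# PURE-SPLITTABLE weighted row families have a nonzero GENERIC determinant (hence are Haar-nonsingular)

Helper file (`--supports stmt-ValiantsHypothesis-22038`; cell valiant-natproofs, rung V4; seat val-np-p4 gen 23).  Closes NO item.

Memo HOME/val-np-p4/g23/ §8.  A weighted row family (rows `(S i, w i)`, columns `T i`, same index type) is PURE-SPLITTABLE (`PS`) if it is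
built from the empty family by
* PENDANT steps — adjoin one row containing a point `q` that occurs in no earlier row (weight `≥ 1` at `q`) together with one column `U`
  contained in no earlier column; and
* PURE SPLIT steps — glue an INSIDE family (rows avoiding a vertex set `I`, columns avoiding a coordinate `c`) and a TOUCHING family (rows
  meeting `I` with a strictly `ρ`-minimal vertex `y i ∈ I`, stated with the weight at `y i` RAISED by one, columns `T₂ j ∌ c`) into the family
  «inside rows ⊔ touching rows (original weights)» on the columns «`T₁ j` ⊔ `T₂ j + c`».
**THEOREM PS** (`det_genTable_ne_zero_of_ps`): the determinant `det[dirE X (S i) (w i) (T j)]` at the GENERIC table `X_{a,c}` (an `MvPolynomial`) is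
nonzero; hence (`exists_table_of_ps`) some complex table makes the family nonsingular.  The steps are the landed lemmas in ambient form
(`pendant_step_ambient`, from the degree/top-coefficient computation of a row through `q := x·𝟙_U`, this file; `det_splitMatrixX_ne_zero`,
`…SplitStep`), applied over the domain `MvPolynomial (π × κ) ℂ` and pulled back to the generic table by a specialisation homomorphism.
THEOREM D2 of the memo (every family of maximum degree ≤ 2 is PS) is the combinatorial existence of such derivations; not formalised here.

WHAT THIS IS NOT: no stub of the line is closed; nothing on crux stmt-ValiantsHypothesis-14610 or on `VP` versus `VNP`.
-/

set_option linter.dupNamespace false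

namespace Summit.ValiantsHypothesis.ValiantsHypothesis.Theorems.BarrierLever.ChowBenchmarkSplit

open Finset Polynomial
open Summit.ValiantsHypothesis.ValiantsHypothesis.Theorems.BarrierLever.ChowBenchmarkPeel (coeff_det_of_natDegree_le indPt)

variable {κ : Type*} [DecidableEq κ] {R : Type*} [CommRing R] {π : Type*} [DecidableEq π]

/-! ## 1. Rows only read their own points -/

/-- Entries of a row `S` only read the table at the points of `S`. -/
theorem dirE_congr_rows {P Q : π → κ → R} {S : Finset π} (w : π → ℕ) (T : Finset κ) (h : ∀ a ∈ S, P a = Q a) :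
    dirE P S w T = dirE Q S w T := by
  unfold dirE
  refine Finset.sum_congr rfl fun g _ => ?_
  congr 1
  exact Finset.prod_congr rfl fun c _ => by rw [h _ (g c).2]

/-! ## 2. The ambient pendant table: one point replaced by `x·𝟙_U` -/

section Pendant

/-- The symbolic pendant table: the point `q` becomes `X·𝟙_U`, the other points are the constants of `P`. -/
noncomputable def pendTableX (P : π → κ → R) (q : π) (U : Finset κ) : π → κ → R[X] :=
  fun a c => if a = q then indPt U X c else C (P a c)

/-- The pendant table at a scalar `x`. -/
def pendTable (P : π → κ → R) (q : π) (U : Finset κ) (x : R) : π → κ → R :=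
  fun a c => if a = q then indPt U x c else P a c

/-- Rows avoiding `q` are constants. -/
theorem dirE_pendTableX_old (P : π → κ → R) (q : π) (U : Finset κ) {S : Finset π} (hS : q ∉ S) (w : π → ℕ) (T : Finset κ) :
    dirE (pendTableX P q U) S w T = C (dirE P S w T) := by
  rw [map_dirE C]
  exact dirE_congr_rows w T fun a ha => by
    funext c
    have : a ≠ q := fun e => hS (e ▸ ha)
    simp [pendTableX, this]

variable (P : π → κ → R) (q : π) (U : Finset κ) (S : Finset π) (w : π → ℕ)

/-- Degree of a coordinate factor of the pendant table. -/
theorem natDegree_pendTableX_le (a : π) (c : κ) :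
    (pendTableX P q U a c).natDegree ≤ if a = q ∧ c ∈ U then 1 else 0 := by
  unfold pendTableX indPt
  by_cases ha : a = q
  · rw [if_pos ha]
    by_cases hc : c ∈ U
    · rw [if_pos hc, if_pos ⟨ha, hc⟩]; exact Polynomial.natDegree_X_le
    · rw [if_neg hc, Polynomial.natDegree_zero]; exact Nat.zero_le _
  · have : ¬ (a = q ∧ c ∈ U) := fun h => ha h.1
    rw [if_neg ha, if_neg this, natDegree_C]

/-- Degree of a summand of a row through `q`. -/
theorem natDegree_prod_pendTableX_le {T : Finset κ} (g : ↥T → ↥S) :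
    (∏ c : ↥T, pendTableX P q U (g c) c).natDegree ≤
      (Finset.univ.filter fun c : ↥T => ((g c : π) = q ∧ (c : κ) ∈ U)).card := by
  refine (Polynomial.natDegree_prod_le _ _).trans ?_
  rw [Finset.card_filter]
  exact Finset.sum_le_sum fun c _ => natDegree_pendTableX_le P q U _ _

/-- **Degree bound**: a row has `x`-degree `≤ |T ∩ U|` at column `T`. -/
theorem natDegree_dirE_pend_le (T : Finset κ) : (dirE (pendTableX P q U) S w T).natDegree ≤ (T ∩ U).card := by
  classical
  unfold dirE
  refine Polynomial.natDegree_sum_le_of_forall_le _ _ fun g _ => ?_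
  refine (Polynomial.natDegree_mul_le).trans ?_
  have h2 : (∏ a : ↥S, (((w a).ascFactorial (Finset.univ.filter fun c : ↥T => g c = a).card : ℕ) : R[X])).natDegree = 0 := by
    rw [← Nat.cast_prod, Polynomial.natDegree_natCast]
  rw [h2, add_zero]
  refine (natDegree_prod_pendTableX_le P q U S g).trans ?_
  rw [← Finset.card_map (Function.Embedding.subtype _)]
  apply Finset.card_le_card
  intro c hc
  simp only [Finset.mem_map, Finset.mem_filter, Finset.mem_univ, true_and, Function.Embedding.coe_subtype] at hc
  obtain ⟨c', ⟨_, hcU⟩, rfl⟩ := hc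
  exact Finset.mem_inter.mpr ⟨c'.2, hcU⟩

/-- The `x^{|U|}`-coefficient vanishes at a column not containing `U`. -/
theorem coeff_dirE_pend_of_not_subset (T : Finset κ) (hT : ¬ U ⊆ T) : (dirE (pendTableX P q U) S w T).coeff U.card = 0 := by
  apply Polynomial.coeff_eq_zero_of_natDegree_lt
  refine lt_of_le_of_lt (natDegree_dirE_pend_le P q U S w T) ?_
  apply Finset.card_lt_card
  refine Finset.ssubset_iff_subset_ne.mpr ⟨Finset.inter_subset_right, fun e => hT ?_⟩
  rw [← e]
  exact Finset.inter_subset_left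

/-- **Top coefficient at the new column**: if `q ∈ S`, the `x^{|U|}`-coefficient at `T = U` is `w_q^{(|U|)}`. -/
theorem coeff_dirE_pend_self (hq : q ∈ S) : (dirE (pendTableX P q U) S w U).coeff U.card = ((w q).ascFactorial U.card : R) := by
  classical
  unfold dirE
  rw [Polynomial.finsetSum_coeff]
  set g₀ : ↥U → ↥S := fun _ => ⟨q, hq⟩ with hg₀
  rw [Finset.sum_eq_single g₀]
  · have hprod : (∏ c : ↥U, pendTableX P q U (g₀ c) c) = X ^ U.card := by
      rw [show (∏ c : ↥U, pendTableX P q U (g₀ c) c) = ∏ c : ↥U, (X : R[X]) from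
        Finset.prod_congr rfl fun c _ => by simp [hg₀, pendTableX, indPt, c.2]]
      rw [Finset.prod_const, Finset.card_univ, Fintype.card_coe]
    have hw : (∏ a : ↥S, (((w a).ascFactorial (Finset.univ.filter fun c : ↥U => g₀ c = a).card : ℕ) : R[X])) =
        (((w q).ascFactorial U.card : ℕ) : R[X]) := by
      rw [Finset.prod_eq_single (⟨q, hq⟩ : ↥S)]
      · have : (Finset.univ.filter fun c : ↥U => g₀ c = ⟨q, hq⟩) = Finset.univ :=
          Finset.filter_true_of_mem fun c _ => rfl
        rw [this, Finset.card_univ, Fintype.card_coe]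
      · intro a _ ha
        have : (Finset.univ.filter fun c : ↥U => g₀ c = a) = ∅ :=
          Finset.filter_false_of_mem fun c _ => fun e => ha (e ▸ rfl)
        rw [this, Finset.card_empty, Nat.ascFactorial_zero, Nat.cast_one]
      · intro h; exact absurd (Finset.mem_univ _) h
    rw [hprod, hw, mul_comm, ← Polynomial.C_eq_natCast, Polynomial.coeff_C_mul_X_pow, if_pos rfl]
  · intro g _ hg
    apply Polynomial.coeff_eq_zero_of_natDegree_lt
    refine (Polynomial.natDegree_mul_le).trans_lt ?_
    have h2 : (∏ a : ↥S, (((w a).ascFactorial (Finset.univ.filter fun c : ↥U => g c = a).card : ℕ) : R[X])).natDegree = 0 := by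
      rw [← Nat.cast_prod, Polynomial.natDegree_natCast]
    rw [h2, add_zero]
    refine (natDegree_prod_pendTableX_le P q U S g).trans_lt ?_
    obtain ⟨c₀, hc₀⟩ : ∃ c₀ : ↥U, ((g c₀ : π)) ≠ q := by
      by_contra hall
      apply hg
      funext c
      apply Subtype.ext
      by_contra hc
      exact hall ⟨c, hc⟩
    rw [← Fintype.card_coe U, ← Finset.card_univ]
    apply Finset.card_lt_card
    refine Finset.ssubset_iff_subset_ne.mpr ⟨Finset.filter_subset _ _, fun e => hc₀ ?_⟩
    have : c₀ ∈ Finset.univ.filter fun c : ↥U => ((g c : π) = q ∧ (c : κ) ∈ U) := by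
      rw [e]; exact Finset.mem_univ _
    exact (Finset.mem_filter.mp this).2.1
  · intro h; exact absurd (Finset.mem_univ _) h

variable {ι : Type*} [Fintype ι] [DecidableEq ι]

/-- The symbolic bordered matrix of a pendant step (ambient form): old rows/columns on `ι`, the new row `Snew ∋ q` and column `U` on `Unit`. -/
noncomputable def pendMatrixX (P : π → κ → R) (q : π) (S : ι → Finset π) (w : ι → π → ℕ) (Snew : Finset π) (wnew : π → ℕ)
    (T : ι → Finset κ) (U : Finset κ) : Matrix (ι ⊕ Unit) (ι ⊕ Unit) R[X] :=
  Matrix.of fun i j => dirE (pendTableX P q U) (Sum.elim S (fun _ => Snew) i) (Sum.elim w (fun _ => wnew) i) (Sum.elim T (fun _ => U) j)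

/-- **The ambient pendant determinant is a nonzero polynomial.** -/
theorem det_pendMatrixX_ne_zero [IsDomain R] (P : π → κ → R) (q : π) (S : ι → Finset π) (w : ι → π → ℕ) (Snew : Finset π)
    (wnew : π → ℕ) (T : ι → Finset κ) (U : Finset κ) (hqS : ∀ i, q ∉ S i) (hq : q ∈ Snew)
    (hw : (((wnew q).ascFactorial U.card : ℕ) : R) ≠ 0) (hU : ∀ j, ¬ U ⊆ T j)
    (hold : (Matrix.of fun i j : ι => dirE P (S i) (w i) (T j)).det ≠ 0) :
    (pendMatrixX P q S w Snew wnew T U).det ≠ 0 := by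
  classical
  set MX := pendMatrixX P q S w Snew wnew T U with hMX
  set v : ι ⊕ Unit → R[X] := Sum.elim (fun _ => X ^ U.card) (fun _ => 1) with hv
  set MX' : Matrix (ι ⊕ Unit) (ι ⊕ Unit) R[X] := Matrix.of fun i j => v i * MX i j with hMX'
  have hdet' : MX'.det = (∏ i, v i) * MX.det := Matrix.det_mul_column v MX
  suffices hne' : MX'.det ≠ 0 by
    intro h0; apply hne'; rw [hdet', h0, mul_zero]
  have hold' : ∀ (i : ι) (j : ι ⊕ Unit), MX (Sum.inl i) j = C (dirE P (S i) (w i) (Sum.elim T (fun _ => U) j)) := by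
    intro i j
    rw [hMX, pendMatrixX, Matrix.of_apply, Sum.elim_inl, Sum.elim_inl, dirE_pendTableX_old P q U (hqS i)]
  have hdeg : ∀ i j, (MX' i j).natDegree ≤ U.card := by
    intro i j
    rw [hMX', Matrix.of_apply]
    cases i with
    | inl i =>
      rw [hv, Sum.elim_inl, hold', mul_comm]
      exact natDegree_C_mul_X_pow_le _ _
    | inr _ =>
      rw [hv, Sum.elim_inr, one_mul, hMX, pendMatrixX, Matrix.of_apply, Sum.elim_inr, Sum.elim_inr]
      exact (natDegree_dirE_pend_le P q U Snew wnew _).trans (Finset.card_le_card Finset.inter_subset_right)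
  have htop : (Matrix.of fun i j => (MX' i j).coeff U.card) =
      Matrix.fromBlocks (Matrix.of fun i j : ι => dirE P (S i) (w i) (T j))
        (Matrix.of fun (i : ι) (_ : Unit) => dirE P (S i) (w i) U)
        0 (Matrix.of fun _ _ : Unit => (((wnew q).ascFactorial U.card : ℕ) : R)) := by
    ext i j
    rcases i with i | i' <;> rcases j with j | j'
    · rw [Matrix.of_apply, Matrix.fromBlocks_apply₁₁, Matrix.of_apply, hMX', Matrix.of_apply, hv, Sum.elim_inl, hold',
        Sum.elim_inl, mul_comm, coeff_C_mul_X_pow, if_pos rfl]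
    · rw [Matrix.of_apply, Matrix.fromBlocks_apply₁₂, Matrix.of_apply, hMX', Matrix.of_apply, hv, Sum.elim_inl, hold',
        Sum.elim_inr, mul_comm, coeff_C_mul_X_pow, if_pos rfl]
    · rw [Matrix.of_apply, Matrix.fromBlocks_apply₂₁, Matrix.zero_apply, hMX', Matrix.of_apply, hv, Sum.elim_inr, one_mul, hMX,
        pendMatrixX, Matrix.of_apply, Sum.elim_inr, Sum.elim_inr, Sum.elim_inl]
      exact coeff_dirE_pend_of_not_subset P q U Snew wnew (T j) (hU j)
    · rw [Matrix.of_apply, Matrix.fromBlocks_apply₂₂, Matrix.of_apply, hMX', Matrix.of_apply, hv, Sum.elim_inr, one_mul, hMX,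
        pendMatrixX, Matrix.of_apply, Sum.elim_inr, Sum.elim_inr, Sum.elim_inr]
      exact coeff_dirE_pend_self P q U Snew wnew hq
  have hcoeff : MX'.det.coeff (Fintype.card (ι ⊕ Unit) * U.card) ≠ 0 := by
    rw [coeff_det_of_natDegree_le MX' U.card hdeg, htop, Matrix.det_fromBlocks_zero₂₁]
    refine mul_ne_zero hold ?_
    rw [Matrix.det_unique, Matrix.of_apply]
    exact hw
  intro h0
  rw [h0, coeff_zero] at hcoeff
  exact hcoeff rfl

end Pendant

/-! ## 3. THEOREM PS: pure-splittable families have a nonzero generic determinant -/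

section PS

/-- The generic table `X_{(a,c)}` over `MvPolynomial (π × κ) ℂ`. -/
noncomputable def genT : π → κ → MvPolynomial (π × κ) ℂ := fun a c => MvPolynomial.X (a, c)

/-- **Pure-splittable weighted row families** (rows `S i` with weights `w i`, columns `T i`; all data over the index type `ι`). -/
inductive PS : ∀ {ι : Type} [Fintype ι] [DecidableEq ι], (ι → Finset π) → (ι → π → ℕ) → (ι → Finset κ) → Prop
  | empty {ι : Type} [Fintype ι] [DecidableEq ι] [IsEmpty ι] (S : ι → Finset π) (w : ι → π → ℕ) (T : ι → Finset κ) : PS S w T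
  | pendant {ι : Type} [Fintype ι] [DecidableEq ι] {S : ι → Finset π} {w : ι → π → ℕ} {T : ι → Finset κ} (h : PS S w T)
      (Snew : Finset π) (wnew : π → ℕ) (q : π) (hq : q ∈ Snew) (hqS : ∀ i, q ∉ S i) (hwq : 1 ≤ wnew q)
      (U : Finset κ) (hU : ∀ j, ¬ U ⊆ T j) :
      PS (Sum.elim S (fun _ : Unit => Snew)) (Sum.elim w (fun _ : Unit => wnew)) (Sum.elim T (fun _ : Unit => U))
  | split {ι₁ ι₂ : Type} [Fintype ι₁] [DecidableEq ι₁] [Fintype ι₂] [DecidableEq ι₂]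
      {S₁ : ι₁ → Finset π} {w₁ : ι₁ → π → ℕ} {T₁ : ι₁ → Finset κ} {S₂ : ι₂ → Finset π} {w₂ : ι₂ → π → ℕ} {T₂ : ι₂ → Finset κ}
      (c : κ) (I : Finset π) (ρ : π → ℕ) (y : ι₂ → π)
      (h₁ : PS S₁ w₁ T₁) (h₂ : PS S₂ (fun i => Function.update (w₂ i) (y i) (w₂ i (y i) + 1)) T₂)
      (hT₁ : ∀ j, c ∉ T₁ j) (hT₂ : ∀ j, c ∉ T₂ j) (hS₁ : ∀ i, ∀ a ∈ S₁ i, a ∉ I)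
      (hyS : ∀ i, y i ∈ S₂ i) (hyI : ∀ i, y i ∈ I) (hdom : ∀ i, ∀ a ∈ S₂ i, a ∈ I → a ≠ y i → ρ (y i) < ρ a)
      (hw : ∀ i, 1 ≤ w₂ i (y i)) :
      PS (Sum.elim S₁ S₂) (Sum.elim w₁ w₂) (Sum.elim T₁ (fun j => insert c (T₂ j)))

/-- The pendant specialisation `X_{q,c} ↦ x·𝟙_U(c)` sends the generic table to the pendant table. -/
theorem aeval_genT_pend [Fintype π] [Fintype κ] (q : π) (U : Finset κ) (a : π) (c : κ) :
    MvPolynomial.aeval (R := ℂ) (S₁ := (MvPolynomial (π × κ) ℂ)[X])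
      (fun p : π × κ => if p.1 = q then indPt U (X : (MvPolynomial (π × κ) ℂ)[X]) p.2 else C (MvPolynomial.X p))
      ((genT : π → κ → MvPolynomial (π × κ) ℂ) a c) = pendTableX ((genT : π → κ → MvPolynomial (π × κ) ℂ)) q U a c := by
  simp [genT, pendTableX]

/-- The split specialisation `X_{a,c} ↦ x^{ρ a}·[a ∈ I]` sends the generic table to the split table. -/
theorem aeval_genT_split [Fintype π] [Fintype κ] (c : κ) (I : Finset π) (ρ : π → ℕ) (a : π) (c' : κ) :
    MvPolynomial.aeval (R := ℂ) (S₁ := (MvPolynomial (π × κ) ℂ)[X])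
      (fun p : π × κ => if p.2 = c then (if p.1 ∈ I then (X : (MvPolynomial (π × κ) ℂ)[X]) ^ ρ p.1 else 0)
        else C (MvPolynomial.X p))
      ((genT : π → κ → MvPolynomial (π × κ) ℂ) a c') = splitTableX ((genT : π → κ → MvPolynomial (π × κ) ℂ)) c I ρ a c' := by
  simp [genT, splitTableX]

/-- **THEOREM PS.**  A pure-splittable weighted family has a nonzero determinant at the generic table. -/
theorem det_genTable_ne_zero_of_ps [Fintype π] [Fintype κ] {ι : Type} [Fintype ι] [DecidableEq ι]
    {S : ι → Finset π} {w : ι → π → ℕ} {T : ι → Finset κ} (h : PS S w T) :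
    (Matrix.of fun i j : ι => dirE ((genT : π → κ → MvPolynomial (π × κ) ℂ)) (S i) (w i) (T j)).det ≠ 0 := by
  classical
  induction h with
  | empty S w T =>
    rw [Matrix.det_isEmpty]
    exact one_ne_zero
  | @pendant ι _ _ S w T h Snew wnew q hq hqS hwq U hU ih =>
    set R₀ := MvPolynomial (π × κ) ℂ
    have hw' : (((wnew q).ascFactorial U.card : ℕ) : R₀) ≠ 0 := by
      have hpos : 0 < (wnew q).ascFactorial U.card := by
        have := Nat.ascFactorial_pos (wnew q - 1) U.card
        rwa [Nat.sub_add_cancel hwq] at this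
      exact Nat.cast_ne_zero.mpr (Nat.pos_iff_ne_zero.mp hpos)
    have hX := det_pendMatrixX_ne_zero ((genT : π → κ → MvPolynomial (π × κ) ℂ)) q S w Snew wnew T U hqS hq hw' hU ih
    set ψ := MvPolynomial.aeval (R := ℂ) (S₁ := R₀[X])
      (fun p : π × κ => if p.1 = q then indPt U (X : R₀[X]) p.2 else C (MvPolynomial.X p)) with hψ
    intro hD
    apply hX
    have e : pendMatrixX ((genT : π → κ → MvPolynomial (π × κ) ℂ)) q S w Snew wnew T U =
        ψ.toRingHom.mapMatrix (Matrix.of fun i j : ι ⊕ Unit =>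
          dirE ((genT : π → κ → MvPolynomial (π × κ) ℂ)) (Sum.elim S (fun _ : Unit => Snew) i) (Sum.elim w (fun _ : Unit => wnew) i)
            (Sum.elim T (fun _ : Unit => U) j)) := by
      refine Matrix.ext fun i j => ?_
      rw [RingHom.mapMatrix_apply, Matrix.map_apply, Matrix.of_apply, pendMatrixX, Matrix.of_apply, map_dirE]
      congr 1
      funext a c
      exact (aeval_genT_pend q U a c).symm
    rw [e, ← RingHom.map_det, hD, map_zero]
  | @split ι₁ ι₂ _ _ _ _ S₁ w₁ T₁ S₂ w₂ T₂ c I ρ y h₁ h₂ hT₁ hT₂ hS₁ hyS hyI hdom hw ih₁ ih₂ =>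
    set R₀ := MvPolynomial (π × κ) ℂ
    have hw' : ∀ i, (w₂ i (y i) : R₀) ≠ 0 := fun i =>
      Nat.cast_ne_zero.mpr (Nat.pos_iff_ne_zero.mp (hw i))
    have hX := det_splitMatrixX_ne_zero ((genT : π → κ → MvPolynomial (π × κ) ℂ)) c I ρ S₁ w₁ S₂ w₂ T₁ T₂ hT₁ hT₂ hS₁ y hyS hyI hdom hw' ih₁ ih₂
    set φ := MvPolynomial.aeval (R := ℂ) (S₁ := R₀[X])
      (fun p : π × κ => if p.2 = c then (if p.1 ∈ I then (X : R₀[X]) ^ ρ p.1 else 0) else C (MvPolynomial.X p)) with hφ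
    intro hD
    apply hX
    have e : splitMatrixX ((genT : π → κ → MvPolynomial (π × κ) ℂ)) c I ρ S₁ w₁ S₂ w₂ T₁ T₂ =
        φ.toRingHom.mapMatrix (Matrix.of fun i j : ι₁ ⊕ ι₂ =>
          dirE ((genT : π → κ → MvPolynomial (π × κ) ℂ)) (Sum.elim S₁ S₂ i) (Sum.elim w₁ w₂ i) (Sum.elim T₁ (fun j => insert c (T₂ j)) j)) := by
      refine Matrix.ext fun i j => ?_
      rw [RingHom.mapMatrix_apply, Matrix.map_apply, Matrix.of_apply, splitMatrixX, Matrix.of_apply, map_dirE]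
      congr 1
      funext a c'
      exact (aeval_genT_split c I ρ a c').symm
    rw [e, ← RingHom.map_det, hD, map_zero]

/-- **THEOREM PS, existence form**: some complex table makes a pure-splittable family nonsingular. -/
theorem exists_table_of_ps [Fintype π] [Fintype κ] {ι : Type} [Fintype ι] [DecidableEq ι]
    {S : ι → Finset π} {w : ι → π → ℕ} {T : ι → Finset κ} (h : PS S w T) :
    ∃ P : π → κ → ℂ, (Matrix.of fun i j : ι => dirE P (S i) (w i) (T j)).det ≠ 0 := by
  classical
  have hD := det_genTable_ne_zero_of_ps h
  by_contra hall
  push Not at hall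
  apply hD
  apply MvPolynomial.funext
  intro x
  rw [map_zero, RingHom.map_det]
  have e : (MvPolynomial.eval x).mapMatrix (Matrix.of fun i j : ι => dirE ((genT : π → κ → MvPolynomial (π × κ) ℂ)) (S i) (w i) (T j)) =
      Matrix.of fun i j : ι => dirE (fun a c => x (a, c)) (S i) (w i) (T j) := by
    refine Matrix.ext fun i j => ?_
    rw [RingHom.mapMatrix_apply, Matrix.map_apply, Matrix.of_apply, Matrix.of_apply, map_dirE]
    congr 1
    funext a c
    simp [genT]
  rw [e]
  exact hall _

end PS

end Summit.ValiantsHypothesis.ValiantsHypothesis.Theorems.BarrierLever.ChowBenchmarkSplit
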